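import Literature.AlgebraicGeometry.ModuliOfAbelianVarieties.SymplecticLiftableOfMarkedFibreCover   -- ★ p849981 zip parts: `pairingReading_comp_of_similitude`, `levelReading_comp_of_congr`, `mixedWeilClause_of_weilDiv_linEquiv`, ★ (b) `exists_symplecticLift_of_levelReading`
import Literature.AlgebraicGeometry.ModuliOfAbelianVarieties.SiegelPrincipalLevelSimilitudeTower    -- ★ `exists_similitudeTower`, `adelicCongr_val_div_of_entries_residue`, `adelicCongr_coe_mul_inv_iff_of_mem_principalLevelSubgroup`
import Literature.AlgebraicGeometry.AbelianSchemes.SymplecticLiftTwist                              -- ★ `SymplecticLift.exists_twist`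
import HarnessLib

/-!
# The symplectic lift of a covered marked complex fibre, EXPOSED with its tower reading; readings of a marking re-indexed along `K_δ(N)`

Topic `AlgebraicGeometry/ModuliOfAbelianVarieties`; namespace `Literature.AlgebraicGeometry.ModuliOfAbelianVarieties`.  THEOREMS ONLY (no definition, no named fact,
no instance, no notation, no `sorry`).  Cell `hodgecm-mathlib` (D-0151), FLOOR 0, P6 «MOD programme» (crux hLiu418 = stmt-HodgeConjecture-24832, `--supports`,
count-neutral); line «L4», (S8) sheet-line closer `Lines/F0_P6a_StubESHEET.lean`, road (γ′) «Serre tensor over `X`, classified», organ **DEAL #41 (B1) «FIBRE LIFT AT THE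
SPECIAL SHEET POINTS OF THE TWISTED TUPLE» — TOWER PART** (LA4-plan (g2) 2026-09-02 09:09:56Z ∕ 09:11:38Z (b); consumers LA7-p01 (g4) (B1) → `hT`∕`hsymp`, LA6-p02 (g3)
(R-CM-3)): the two GENERIC lemmas the point assembly needs.

* **`SiegelAdelicMarking.exists_symplecticLift_of_markedComplexFibre_comp`** — the ★ p849981 zip `isSymplecticLiftable_of_markedComplexFibre_comp` AT ONE POINT and with
  the lift EXPOSED: same binders WITHOUT `[PreconnectedSpace S]`, `[IsLocallyNoetherian S]`, `[IsReduced S]`, `hg'`, `hQ`, `pol'`, `hΘ'`; conclusion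
  `∃ Λ' : φ'.SymplecticLift s₀ Θ' δ` whose WHOLE TOWER is read through `r` by the target marking `m'` (`r⁻¹ v̂ ≡ x̃∕M ⟹ Λ'_M(x) = u'(v)`) — the readings of
  `(B, m, Θ)` are transferred through `c : B → B′`, `u′ = c ∘ u`, by ★ [L2-pair] `pairingReading_comp_of_similitude` (with ★ `mixedWeilClause_of_weilDiv_linEquiv`) and
  ★ [L2-level] `levelReading_comp_of_congr`, then ★ (b) `exists_symplecticLift_of_levelReading` BUILDS the lift ([Lan2013PELCompactifications] Lemma 1.3.6.5).
* **`SiegelAdelicMarking.exists_readings_of_symplecticLift_of_mem_principalLevelSubgroup`** — RE-INDEXING ALONG `K_δ(N)`: if a symplectic lift `Λ` of `φ(s)` is read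
  by the marking `m` (index `a`) through `k·a⁻¹` with `k ∈ K_δ(N)` (the shape of ★ σ1-UNPACK p850665: `m` indexed by the moved representative `r′ = rep·k`, `Λ` read
  through `rep⁻¹ = k·r′⁻¹`), then `m` carries the pairing reading `hpair` (for the roots of the TWISTED lift `Λ·k̄`, ★ `SymplecticLift.exists_twist` along the
  similitude tower of `k`, ★ `exists_similitudeTower`; relabelling ★ `adelicCongr_val_div_of_entries_residue`) and the level reading `hlevel` through ITS OWN index `a⁻¹`
  (`K_δ(N)` acts trivially on `N`-torsion, ★ `adelicCongr_coe_mul_inv_iff_of_mem_principalLevelSubgroup`) — exactly the source binders of the first lemma.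
Budgets: default heartbeats.

References: [Lan2013PELCompactifications] K.-W. Lan, *Arithmetic compactifications of PEL-type Shimura varieties* (2013), §1.3.6 Def. 1.3.6.2 (p. 80), Lemma 1.3.6.5,
Lemma 1.3.6.6, Cor. 1.3.6.7 (pp. 81–82); [Deligne1971TravauxShimura] P. Deligne, *Travaux de Shimura* (1971), 4.12 (b) p. 149, 4.16 p. 150;
[Milne2005ShimuraVarieties] J. S. Milne, *Introduction to Shimura varieties* (2005), §6 Thm. 6.11 pp. 74–75, §12 (63) p. 116; [MumfordAV1970] D. Mumford, *Abelian Varieties*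
(1970), §20 pp. 184–186, §23 Thm. 2 p. 231.  HC_CM is proved only modulo the printed citations (2 remaining named inputs hLiu418 24832, h413 24833) until rung 0 closes —
count-neutral.
-/

set_option autoImplicit false

noncomputable section

open CategoryTheory AlgebraicGeometry Matrix NumberField IsDedekindDomain
open Literature.AlgebraicGeometry.Motives (AbelianVariety AlgPoints CartierDivisor)
open Literature.AlgebraicGeometry.AbelianSchemes (AbelianSchemeOver)

namespace Literature.AlgebraicGeometry.ModuliOfAbelianVarieties

open SiegelModuli
open Literature.NumberTheory.Adeles (latticeOfGL)

/-! ## §1 The lift of the covered marked fibre, exposed -/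

/-- **THE SYMPLECTIC LIFT OF `(B′_{s₀}, φ′, Θ′)` FROM ONE MARKED COMPLEX FIBRE OF `B` AND THE QUOTIENT MARKING OF `B′`, EXPOSED WITH ITS TOWER READING** — the per-point,
lift-valued form of ★ `isSymplecticLiftable_of_markedComplexFibre_comp` (no `PreconnectedSpace`, no ampleness, no `IsLambdaOfAt`): the readings `hpair`∕`hlevel` of
`(B, m, Θ)` through `r′` pass through the cover `c` (`u′ = c ∘ u`, integrality `hT`, similitude `hμ`∕`hε`, congruence `hk`, divisor clause `hdiv`) to `(B′, m′, Θ′)`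
read through `r`, and ★ (b) builds a symplectic lift `Λ′` of `φ′(s₀)` for `Θ′` whose tower is read through `r` by `m′`.
[cite: Lan2013PELCompactifications, §1.3.6 Lemma 1.3.6.5 (p. 81), Lemma 1.3.6.6 and Cor. 1.3.6.7 (pp. 81–82)] [cite: MumfordAV1970, §20 (pp. 184–186) and §23 (Thm. 2, p. 231)]
[cite: Milne2005ShimuraVarieties, §6 Thm. 6.11 p. 74 and §12 (63) p. 116] -/
theorem SiegelAdelicMarking.exists_symplecticLift_of_markedComplexFibre_comp {g : ℕ} {δ : Fin g → ℕ}
    {J J' : C0pm δ} {r' r : gspFinAdelic δ}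
    {S : Scheme.{0}} {B B' : AbelianSchemeOver S} {N : ℕ} (φ : B.LevelStructure g N) (φ' : B'.LevelStructure g N)
    (c : B.X ⟶ B'.X) [IsMonHom c] (hφ' : ∀ i, φ'.σ i = φ.σ i ≫ c) {s₀ : Spec (.of ℂ) ⟶ S}
    [IsDominant (AbelianVariety.Hom.toSchemeHom (AbelianSchemeOver.fibreHom c s₀))]
    (Θ : CartierDivisor (B.fibre s₀).toAbelianVariety.X.left) (Θ' : CartierDivisor (B'.fibre s₀).toAbelianVariety.X.left) {ν : ℕ} (hν : ν ≠ 0)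
    (hdiv : ∀ Q : (B.fibre s₀).toAbelianVariety.Points ℂ,
      ((B.fibre s₀).toAbelianVariety.weilDiv (Θ'.pullback (AbelianVariety.Hom.toSchemeHom (AbelianSchemeOver.fibreHom c s₀))) Q).LinEquiv
        (ν • (B.fibre s₀).toAbelianVariety.weilDiv Θ Q))
    (m : SiegelAdelicMarking J r' (B.fibre s₀).toAbelianVariety) (m' : SiegelAdelicMarking J' r (B'.fibre s₀).toAbelianVariety)
    (hm' : ∀ v, m'.r v = AlgPoints.map (AbelianSchemeOver.fibreHom c s₀).hom.hom.hom (m.r v))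
    (hT : ∀ i j, (ν : finAdeleQ) *
      (((r'⁻¹ * r : gspFinAdelic δ) : GL (Fin g ⊕ Fin g) finAdeleQ) : Matrix (Fin g ⊕ Fin g) (Fin g ⊕ Fin g) finAdeleQ) i j ∈
        FiniteAdeleRing.integralAdeles (𝓞 ℚ) ℚ)
    {μ : finAdeleQˣ} (hμ : IsMultiplier (typeFormOver δ finAdeleQ) ((r'⁻¹ * r : gspFinAdelic δ) : GL (Fin g ⊕ Fin g) finAdeleQ) μ)
    (ε : (FiniteAdeleRing.integralAdeles (𝓞 ℚ) ℚ)ˣ)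
    (hε : ((ε : FiniteAdeleRing.integralAdeles (𝓞 ℚ) ℚ) : finAdeleQ) = (ν : finAdeleQ) * (μ : finAdeleQ))
    (hk : ∀ i j, ∃ t ∈ FiniteAdeleRing.integralAdeles (𝓞 ℚ) ℚ,
      ((((r⁻¹ * r' : gspFinAdelic δ) : GL (Fin g ⊕ Fin g) finAdeleQ) : Matrix (Fin g ⊕ Fin g) (Fin g ⊕ Fin g) finAdeleQ) - 1) i j =
        (N : finAdeleQ) * t)
    (ζ : ℕ → ℂ) (hζ : ∀ ⦃M : ℕ⦄, N ∣ M → M ≠ 0 → IsPrimitiveRoot (ζ M) M)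
    (hζ_pow : ∀ ⦃M : ℕ⦄ (k : ℕ), N ∣ M → M ≠ 0 → k ≠ 0 → ζ (k * M) ^ k = ζ M)
    (hpair : ∀ ⦃M : ℕ⦄, N ∣ M → ∀ (hMΩ : (M : ℂ) ≠ 0) (x y : Fin g ⊕ Fin g → ZMod M)
      (P Q : (B.fibre s₀).toAbelianVariety.torsionPoints ℂ (M : ℤ)),
      (∀ v, AdelicCongr ((r'⁻¹ : gspFinAdelic δ) : GL (Fin g ⊕ Fin g) finAdeleQ) 1 v
          (fun i => ((x i).val : ℚ) / M) → (P : (B.fibre s₀).toAbelianVariety.Points ℂ) = m.r v) →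
      (∀ w, AdelicCongr ((r'⁻¹ : gspFinAdelic δ) : GL (Fin g ⊕ Fin g) finAdeleQ) 1 w
          (fun i => ((y i).val : ℚ) / M) → (Q : (B.fibre s₀).toAbelianVariety.Points ℂ) = m.r w) →
      haveI := AbelianVariety.isDominant_toSchemeHom_zsmul_of_ne_zero (B.fibre s₀).toAbelianVariety hMΩ
      (B.fibre s₀).toAbelianVariety.weilPairingLevel Θ P Q = ζ M ^ (AbelianSchemeOver.typeFormMod δ M x y).val)
    (hlevel : ∀ i : Fin g ⊕ Fin g, ∃ v : Fin g ⊕ Fin g → ℚ,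
      AdelicCongr ((r'⁻¹ : gspFinAdelic δ) : GL (Fin g ⊕ Fin g) finAdeleQ) 1 v
          (fun j => (((Pi.single i (1 : ZMod N) : Fin g ⊕ Fin g → ZMod N) j).val : ℚ) / N) ∧
        B.restrictPt s₀ (φ.σ i) = m.r v) :
    ∃ Λ' : φ'.SymplecticLift s₀ Θ' δ,
      ∀ ⦃M : ℕ⦄, N ∣ M → M ≠ 0 → ∀ (x : Fin g ⊕ Fin g → ZMod M) (v : Fin g ⊕ Fin g → ℚ),
        AdelicCongr ((r⁻¹ : gspFinAdelic δ) : GL (Fin g ⊕ Fin g) finAdeleQ) 1 v (fun i => ((x i).val : ℚ) / M) →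
          ((Λ'.lift M (Multiplicative.ofAdd x)) : (B'.fibre s₀).toAbelianVariety.Points ℂ) = m'.r v := by
  obtain ⟨ζ', hζ', hζ'_pow, hpair'⟩ := SiegelAdelicMarking.pairingReading_comp_of_similitude c m m' hm' hν hT hμ ε hε Θ Θ' ζ hζ hζ_pow hpair
    (AbelianSchemeOver.mixedWeilClause_of_weilDiv_linEquiv c hν Θ Θ' hdiv N)
  obtain ⟨Λ', -, hΛ'⟩ := m'.exists_symplecticLift_of_levelReading φ' Θ' ζ' hζ' hζ'_pow hpair'
    (SiegelAdelicMarking.levelReading_comp_of_congr c m m' hm' φ φ' hφ' hk hlevel)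
  exact ⟨Λ', hΛ'⟩

/-! ## §2 Readings of a marking re-indexed along `K_δ(N)` -/

/-- **RE-INDEXING A SYMPLECTIC READING ALONG `k ∈ K_δ(N)`.**  Let `m` mark the complex fibre `B_s` by `[J, a]` and let `Λ` be a symplectic lift of `φ(s)` for `Θ` whose
tower is read by `m` through `k·a⁻¹`, `k ∈ K_δ(N)`: `(k a⁻¹) v̂ ≡ x̃∕M ⟹ Λ_M(x) = u(v)`.  THEN `m` carries, through ITS OWN index `a⁻¹`, (i) a compatible system `ζ′` of
primitive roots with the pairing reading `hpair` — the roots of the twisted lift `Λ·k̄` (★ `SymplecticLift.exists_twist` along the similitude tower `(k̄_M, ν(k)_M)_M` of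
★ `exists_similitudeTower`): `a⁻¹ v̂ ≡ x̃∕M ⟹ k a⁻¹ v̂ ≡ (k̄_M x)~∕M` (★ `adelicCongr_val_div_of_entries_residue`) so `u(v) = Λ_M(k̄_M x) = (Λ·k̄)_M(x)` — and (ii) the
level reading `hlevel` (`k ≡ 1 (mod N)` acts trivially on `N⁻¹Λ_a`, ★ `adelicCongr_coe_mul_inv_iff_of_mem_principalLevelSubgroup`).  Deligne's `K = GSp(ẑ)` acting on the
similitude classes, read on markings. [cite: Deligne1971TravauxShimura, 4.12 (b) p. 149 and 4.16 p. 150] [cite: Milne2005ShimuraVarieties, §6 Thm. 6.11 p. 74, (63) p. 116 and p. 75]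
[cite: Lan2013PELCompactifications, §1.3.6 Lemma 1.3.6.5 (p. 81)] -/
theorem SiegelAdelicMarking.exists_readings_of_symplecticLift_of_mem_principalLevelSubgroup {g : ℕ} {δ : Fin g → ℕ}
    (hδ : IsPolarizationType δ) (hg : 0 < g) {J : C0pm δ} {a k : gspFinAdelic δ} {N : ℕ} (hN : N ≠ 0)
    (hk : k ∈ principalLevelSubgroup δ N)
    {S : Scheme.{0}} {B : AbelianSchemeOver S} [IsCommMonObj B.X] {s : Spec (.of ℂ) ⟶ S}
    (φ : B.LevelStructure g N) (Θ : CartierDivisor (B.fibre s).toAbelianVariety.X.left) (Λ : φ.SymplecticLift s Θ δ)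
    (m : SiegelAdelicMarking J a (B.fibre s).toAbelianVariety)
    (hread : ∀ ⦃M : ℕ⦄, N ∣ M → M ≠ 0 → ∀ (x : Fin g ⊕ Fin g → ZMod M) (v : Fin g ⊕ Fin g → ℚ),
      AdelicCongr ((k * a⁻¹ : gspFinAdelic δ) : GL (Fin g ⊕ Fin g) finAdeleQ) 1 v (fun i => ((x i).val : ℚ) / M) →
        ((Λ.lift M (Multiplicative.ofAdd x)) : (B.fibre s).toAbelianVariety.Points ℂ) = m.r v) :
    ∃ ζ : ℕ → ℂ, (∀ ⦃M : ℕ⦄, N ∣ M → M ≠ 0 → IsPrimitiveRoot (ζ M) M) ∧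
      (∀ ⦃M : ℕ⦄ (k : ℕ), N ∣ M → M ≠ 0 → k ≠ 0 → ζ (k * M) ^ k = ζ M) ∧
      (∀ ⦃M : ℕ⦄, N ∣ M → ∀ (hMΩ : (M : ℂ) ≠ 0) (x y : Fin g ⊕ Fin g → ZMod M)
        (P Q : (B.fibre s).toAbelianVariety.torsionPoints ℂ (M : ℤ)),
        (∀ v, AdelicCongr ((a⁻¹ : gspFinAdelic δ) : GL (Fin g ⊕ Fin g) finAdeleQ) 1 v
            (fun i => ((x i).val : ℚ) / M) → (P : (B.fibre s).toAbelianVariety.Points ℂ) = m.r v) →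
        (∀ w, AdelicCongr ((a⁻¹ : gspFinAdelic δ) : GL (Fin g ⊕ Fin g) finAdeleQ) 1 w
            (fun i => ((y i).val : ℚ) / M) → (Q : (B.fibre s).toAbelianVariety.Points ℂ) = m.r w) →
        haveI := AbelianVariety.isDominant_toSchemeHom_zsmul_of_ne_zero (B.fibre s).toAbelianVariety hMΩ
        (B.fibre s).toAbelianVariety.weilPairingLevel Θ P Q = ζ M ^ (AbelianSchemeOver.typeFormMod δ M x y).val) ∧
      (∀ i : Fin g ⊕ Fin g, ∃ v : Fin g ⊕ Fin g → ℚ,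
        AdelicCongr ((a⁻¹ : gspFinAdelic δ) : GL (Fin g ⊕ Fin g) finAdeleQ) 1 v
            (fun j => (((Pi.single i (1 : ZMod N) : Fin g ⊕ Fin g → ZMod N) j).val : ℚ) / N) ∧
          B.restrictPt s (φ.σ i) = m.r v) := by
  classical
  haveI : NeZero N := ⟨hN⟩
  have hk1 : k ∈ principalLevelSubgroup δ 1 := principalLevelSubgroup_anti δ (one_dvd N) hk
  -- integrality of the entries of `k`
  have hkint : ∀ i j, ((k : GL (Fin g ⊕ Fin g) finAdeleQ) : Matrix (Fin g ⊕ Fin g) (Fin g ⊕ Fin g) finAdeleQ) i j ∈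
      FiniteAdeleRing.integralAdeles (𝓞 ℚ) ℚ := fun i j =>
    isIntegral_of_isCongOne_one (A := ((k : GL (Fin g ⊕ Fin g) finAdeleQ) : Matrix (Fin g ⊕ Fin g) (Fin g ⊕ Fin g) finAdeleQ))
      ((mem_principalLevelSubgroup_iff δ).1 hk1).1 i j
  -- the similitude tower of `k` and the twisted lift `Λ·k̄`
  obtain ⟨Γ, νt, hent, hΓc, hνc, hsim⟩ := exists_similitudeTower δ hδ hg hk1
  obtain ⟨Λ', hΛ'⟩ := Λ.exists_twist Γ νt (fun M k' _ hM0 hk' => hΓc k' hM0 hk') (fun M k' _ hM0 hk' => hνc k' hM0 hk')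
    (fun M _ hM0 => hsim hM0)
  -- a partner through `a⁻¹` is read by `Λ` at the relabelled index `k̄_M x`
  have hcoe : ((k * a⁻¹ : gspFinAdelic δ) : GL (Fin g ⊕ Fin g) finAdeleQ) =
      (k : GL (Fin g ⊕ Fin g) finAdeleQ) * ((a⁻¹ : gspFinAdelic δ) : GL (Fin g ⊕ Fin g) finAdeleQ) := rfl
  have hrelabel : ∀ ⦃M : ℕ⦄, N ∣ M → M ≠ 0 → ∀ (x : Fin g ⊕ Fin g → ZMod M) (v : Fin g ⊕ Fin g → ℚ),
      AdelicCongr ((a⁻¹ : gspFinAdelic δ) : GL (Fin g ⊕ Fin g) finAdeleQ) 1 v (fun i => ((x i).val : ℚ) / M) →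
        ((Λ'.lift M (Multiplicative.ofAdd x)) : (B.fibre s).toAbelianVariety.Points ℂ) = m.r v := by
    intro M hM hM0 x v hv
    haveI : NeZero M := ⟨hM0⟩
    rw [hΛ' M x]
    refine hread hM hM0 _ v ?_
    have h1 : AdelicCongr ((k : GL (Fin g ⊕ Fin g) finAdeleQ) * ((a⁻¹ : gspFinAdelic δ) : GL (Fin g ⊕ Fin g) finAdeleQ))
        ((k : GL (Fin g ⊕ Fin g) finAdeleQ) * 1) v (fun i => ((x i).val : ℚ) / M) := hv.mul_left hkint
    rw [mul_one] at h1
    rw [hcoe]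
    exact h1.trans (adelicCongr_val_div_of_entries_residue hk1 (Γ M : Matrix (Fin g ⊕ Fin g) (Fin g ⊕ Fin g) (ZMod M))
      (fun i j h => hent M i j h) x)
  refine ⟨Λ'.ζ, Λ'.isPrimitiveRoot_ζ, Λ'.ζ_pow, fun M hM hMΩ x y P Q hP hQ => ?_, fun i => ?_⟩
  · -- the pairing reading: `P = Λ′_M(x)`, `Q = Λ′_M(y)`
    have hM0 : M ≠ 0 := by rintro rfl; exact hMΩ (by rw [Nat.cast_zero])
    obtain ⟨v, hv⟩ := SiegelAdelicMarking.exists_adelicCongr_inv_one (a := a) (fun i => ((x i).val : ℚ) / M)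
    obtain ⟨w, hw⟩ := SiegelAdelicMarking.exists_adelicCongr_inv_one (a := a) (fun i => ((y i).val : ℚ) / M)
    have hPx : P = Λ'.lift M (Multiplicative.ofAdd x) := Subtype.ext ((hP v hv).trans (hrelabel hM hM0 x v hv).symm)
    have hQy : Q = Λ'.lift M (Multiplicative.ofAdd y) := Subtype.ext ((hQ w hw).trans (hrelabel hM hM0 y w hw).symm)
    haveI := AbelianVariety.isDominant_toSchemeHom_zsmul_of_ne_zero (B.fibre s).toAbelianVariety hMΩ
    rw [hPx, hQy]
    exact Λ'.weilPairingLevel_lift hM hMΩ x y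
  · -- the level reading at level `N`: `K_δ(N)` acts trivially on `N⁻¹Λ_a`
    obtain ⟨v, hv⟩ := SiegelAdelicMarking.exists_adelicCongr_inv_one (a := a)
      (fun j => (((Pi.single i (1 : ZMod N) : Fin g ⊕ Fin g → ZMod N) j).val : ℚ) / N)
    refine ⟨v, hv, ?_⟩
    have hNv : N • v ∈ latticeOfGL ((a : gspFinAdelic δ) : GL (Fin g ⊕ Fin g) finAdeleQ) := by
      have h := (hv.nsmul_mem_latticeOfGL_iff N).2
        (by simpa only [inv_one] using SiegelAdelicMarking.nsmul_valDiv_mem_latticeOfGL_one (g := g) N (Pi.single i (1 : ZMod N)))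
      simpa only [Subgroup.coe_inv, inv_inv] using h
    rw [← Λ.lift_level i]
    exact hread (dvd_refl N) hN (Pi.single i 1) v
      ((adelicCongr_coe_mul_inv_iff_of_mem_principalLevelSubgroup (b' := 1) hk hNv).2 hv)

/-! ## §3 (ED. 2) A lift read through `k·a⁻¹`, `k ∈ K_δ(N)`, is replaced by a lift read through `a⁻¹` -/

/-- **RE-INDEXED LIFT**: if a symplectic lift `Λ` of `φ(s)` for `Θ` is read by the marking `m` (index `a`) through `k·a⁻¹` with `k ∈ K_δ(N)`, then there is a symplectic lift `Λ′`
of `φ(s)` for the same `Θ` read by `m` through ITS OWN index `a⁻¹` (§2 `exists_readings_of_symplecticLift_of_mem_principalLevelSubgroup` + ★ (b)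
`exists_symplecticLift_of_levelReading`; `Λ′ = Λ·k̄` up to the roots) — Deligne's `K = GSp(ẑ)` acting on similitude classes, the `K_δ(N)`-part being invisible at level `N`.
[cite: Deligne1971TravauxShimura, 4.12 (b) p. 149 and 4.16 p. 150] [cite: Lan2013PELCompactifications, §1.3.6 Lemma 1.3.6.5 (p. 81)] [cite: Milne2005ShimuraVarieties, §6 Thm. 6.11 p. 74 and p. 75] -/
theorem SiegelAdelicMarking.exists_symplecticLift_of_read_mul_of_mem_principalLevelSubgroup {g : ℕ} {δ : Fin g → ℕ}
    (hδ : IsPolarizationType δ) (hg : 0 < g) {J : C0pm δ} {a k : gspFinAdelic δ} {N : ℕ} (hN : N ≠ 0)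
    (hk : k ∈ principalLevelSubgroup δ N)
    {S : Scheme.{0}} {B : AbelianSchemeOver S} [IsCommMonObj B.X] {s : Spec (.of ℂ) ⟶ S}
    (φ : B.LevelStructure g N) (Θ : CartierDivisor (B.fibre s).toAbelianVariety.X.left) (Λ : φ.SymplecticLift s Θ δ)
    (m : SiegelAdelicMarking J a (B.fibre s).toAbelianVariety)
    (hread : ∀ ⦃M : ℕ⦄, N ∣ M → M ≠ 0 → ∀ (x : Fin g ⊕ Fin g → ZMod M) (v : Fin g ⊕ Fin g → ℚ),
      AdelicCongr ((k * a⁻¹ : gspFinAdelic δ) : GL (Fin g ⊕ Fin g) finAdeleQ) 1 v (fun i => ((x i).val : ℚ) / M) →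
        ((Λ.lift M (Multiplicative.ofAdd x)) : (B.fibre s).toAbelianVariety.Points ℂ) = m.r v) :
    ∃ Λ' : φ.SymplecticLift s Θ δ,
      ∀ ⦃M : ℕ⦄, N ∣ M → M ≠ 0 → ∀ (x : Fin g ⊕ Fin g → ZMod M) (v : Fin g ⊕ Fin g → ℚ),
        AdelicCongr ((a⁻¹ : gspFinAdelic δ) : GL (Fin g ⊕ Fin g) finAdeleQ) 1 v (fun i => ((x i).val : ℚ) / M) →
          ((Λ'.lift M (Multiplicative.ofAdd x)) : (B.fibre s).toAbelianVariety.Points ℂ) = m.r v := by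
  obtain ⟨ζ, hζ, hζ_pow, hpair, hlevel⟩ :=
    SiegelAdelicMarking.exists_readings_of_symplecticLift_of_mem_principalLevelSubgroup hδ hg hN hk φ Θ Λ m hread
  obtain ⟨Λ', -, hΛ'⟩ := m.exists_symplecticLift_of_levelReading φ Θ ζ hζ hζ_pow hpair hlevel
  exact ⟨Λ', hΛ'⟩

end Literature.AlgebraicGeometry.ModuliOfAbelianVarieties

end
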